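import Mathlib
import Summits.Ventures.HodgeRepro2.T5CompletionDegreeOfUnique
import Summits.Ventures.HodgeRepro2.T5QuadraticGalois
import Summits.Ventures.HodgeRepro2.T6N5LocalSignModel

/-!
# T6N5LocalSignModelGlobal — Tier 6, M2 sub-step N5 (t6-p8's half): THE PLACE FAMILY OF A QUADRATIC EXTENSION OF
NUMBER FIELDS FROM THE GLOBAL STRUCTURE — the place data of every finite non-split place are THEOREMS of the number
fields (p4's global dictionary), so that the sign model of `T6N5LocalSignModel` is built from the three local data
`(P, ψ_δ, R)` per finite non-split place and the real-place data alone

For `K ⊆ L` number fields with `[L : K] = 2`: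
* `exists_placeData` / `placeData` — at a finite place `v` of `K` with `w` the ONLY place of `L` above it, the place
  data of the per-place statements of record exist: `[L_w : K_v] = 2` (p4's `T5CompletionDegreeOfUnique`), uniformisers
  of `K_v` and `L_w` (Mathlib's discrete valuation rings), a non-trivial automorphism `σ` (p4's `T5QuadraticGalois`,
  separability from characteristic `0`), and the place is inert or ramified by the dichotomy «`ϖ` irreducible in
  `O_{L_w}`» (p4's `T5AdicCompletionRamified`: `e = 1` or `e = 2`);
* `ThreeData v w` — the three local data of the N side at the place with their two facts (`ψ_δ` trivial on `K_v`,
  the Weil carrier non-zero); `LocalInput.ofUnique` / `NSPlace.ofUnique` — the local input from the global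
  non-splitness and the three data;
* `GlobalIndex K` — THE INDEX TYPE OF THE PLACES of `K` the route reads: the finite places and the real places;
  `IsNonSplit K L v` — exactly one place of `L` lies above `v`; `kindOf` — the kind from the global structure (`ns`
  at a non-split finite place, `sp` at the other finite places, `re` at a real place), with `kindOf_inl` / `kindOf_inr`
  / `isNonSplit_of_kindOf` / `kindOf_eq_ns` / `kindOf_inr_ne_ns` / `exists_eq_inr_of_kindOf_eq_re`; `placeAbove h` —
  the place of `L` above a non-split `v` (`placeAbove_liesOver`, an instance, so that `L_{placeAbove h}` is a
  `K_v`-algebra; `placeAbove_unique`); `ThreeDataFamily K L` — the three data at every non-split finite place;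
  `localInputAt` — the local input there; `PlaceFamily.ofGlobal` — the place family with the local input
  `ofUnique` at every finite non-split place; `ofGlobal_hyps_iff` — its per-place hypotheses are those of the three
  data at every non-split finite place;
* `exists_signModel_ofGlobal` — THE HOST-SHAPED STATEMENT: for three data at every finite non-split place satisfying
  the per-place hypotheses, and real data on both sides at every real place satisfying t6-p7's three hypotheses,
  there is a sign model on `GlobalIndex K` with `Solves ∧ RealCondB` (ledger rows 183–184) whose kinds are the
  global ones and whose local data are the statements of record's.
What a continuation on the host still supplies is exactly the input of this theorem: the three data per finite
non-split place of `F = K⁺` in `E = K` (Tate's ε-factor parameter, the datum's `ψ_δ`, the Weil representation — with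
the displays `Hyps` on them) and t6-p7's real data.  No display lives here; nothing automorphic is constructed.
README §8(d): uses an L-value-free non-vanishing device: NO.
-/

namespace Summit.Ventures.HodgeRepro2.T6.N5LocalSignModelGlobal

open Summit.Ventures.HodgeRepro2 IsDedekindDomain HeightOneSpectrum
  Summit.Ventures.HodgeRepro2.T6.N5LocalDatum Summit.Ventures.HodgeRepro2.T6.N5Local
  Summit.Ventures.HodgeRepro2.T6.N5LocalTateChars Summit.Ventures.HodgeRepro2.T6.N5LocalWeilQuotient
  Summit.Ventures.HodgeRepro2.T6.N5LocalInertToyEps Summit.Ventures.HodgeRepro2.T6.N5LocalRamToyEps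
  Summit.Ventures.HodgeRepro2.T6.N5Rich Summit.Ventures.HodgeRepro2.T6.N5RealPlace
  Summit.Ventures.HodgeRepro2.T6.N5LocalSignModel

noncomputable section

/-! ### The place data of a non-split place from the global structure -/

section Place

variable {K : Type} [Field K] [NumberField K] (v : HeightOneSpectrum (NumberField.RingOfIntegers K))
  {L : Type} [Field L] [NumberField L] [Algebra K L] (w : HeightOneSpectrum (NumberField.RingOfIntegers L))
  [w.asIdeal.LiesOver v.asIdeal]

/-- THE PLACE DATA EXIST at the only place `w` of `L` above `v` (quadratic `L/K`): the local degree is `2`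
(`T5CompletionDegreeOfUnique.finrank_eq_two_of_unique`), uniformisers exist (discrete valuation rings), a non-trivial
automorphism exists (`T5QuadraticGalois.exists_ne_one`), and the place is inert or ramified according to whether the
uniformiser of `K_v` stays irreducible in `O_{L_w}`. -/
theorem exists_placeData (hKL : Module.finrank K L = 2)
    (huniq : ∀ w' : HeightOneSpectrum (NumberField.RingOfIntegers L), w'.asIdeal.LiesOver v.asIdeal → w' = w) :
    Nonempty (InertPlace v w ⊕ RamPlace v w) := by
  have h2 := T5CompletionDegreeOfUnique.finrank_eq_two_of_unique v w hKL huniq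
  obtain ⟨ϖ, hϖ⟩ := IsDiscreteValuationRing.exists_irreducible (v.adicCompletionIntegers K)
  obtain ⟨π, hπ⟩ := IsDiscreteValuationRing.exists_irreducible (w.adicCompletionIntegers L)
  haveI : FiniteDimensional (v.adicCompletion K) (w.adicCompletion L) :=
    Module.finite_of_finrank_pos (by rw [h2]; exact two_pos)
  obtain ⟨σ, hσ⟩ := T5QuadraticGalois.exists_ne_one h2
  by_cases hS : Irreducible (algebraMap (v.adicCompletionIntegers K) (w.adicCompletionIntegers L) ϖ)
  · exact ⟨Sum.inl ⟨h2, ϖ, hϖ, hS, σ, hσ⟩⟩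
  · exact ⟨Sum.inr ⟨h2, ϖ, hϖ, π, hπ, hS, σ, hσ⟩⟩

/-- A choice of place data at the only place above `v`. -/
def placeData (hKL : Module.finrank K L = 2)
    (huniq : ∀ w' : HeightOneSpectrum (NumberField.RingOfIntegers L), w'.asIdeal.LiesOver v.asIdeal → w' = w) :
    InertPlace v w ⊕ RamPlace v w :=
  (exists_placeData v w hKL huniq).some

/-- THE THREE LOCAL DATA of the N side at the place, with their two facts: Tate's ε-factor parameter `P`, the datum's
`ψ_δ` trivial on `K_v`, the carried Weil representation `R`, non-zero. Data only. -/
structure ThreeData where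
  /-- Tate's ε-factor parameter -/
  P : TateParams (w.adicCompletion L)ˣ (PsiC w) ℝ
  /-- the datum's additive character `ψ_δ` of `L_w` -/
  ψδ : PsiC w
  /-- … trivial on `K_v` -/
  hK : ∀ a : v.adicCompletion K, ψδ.1 (algebraMap (v.adicCompletion K) (w.adicCompletion L) a) = 1
  /-- the carried Weil representation -/
  R : WeilRep v w
  /-- … non-zero for both signs -/
  nontriv : ∀ s, Nontrivial (R.Wsp s)

/-- The local input at the only place above `v` from the global non-splitness and the three data. -/
def LocalInput.ofUnique (hKL : Module.finrank K L = 2)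
    (huniq : ∀ w' : HeightOneSpectrum (NumberField.RingOfIntegers L), w'.asIdeal.LiesOver v.asIdeal → w' = w)
    (T : ThreeData v w) : LocalInput v w where
  place := placeData v w hKL huniq
  P := T.P
  ψδ := T.ψδ
  hK := T.hK
  R := T.R
  nontriv := T.nontriv

/-- The finite non-split place `v` with its input, from the global non-splitness and the three data. -/
def NSPlace.ofUnique (hKL : Module.finrank K L = 2)
    (huniq : ∀ w' : HeightOneSpectrum (NumberField.RingOfIntegers L), w'.asIdeal.LiesOver v.asIdeal → w' = w)
    (T : ThreeData v w) : NSPlace K L where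
  v := v
  w := w
  X := LocalInput.ofUnique v w hKL huniq T

end Place

/-! ### The places of `K` and the kind of each from the global structure -/

section Global

variable (K : Type) [Field K] [NumberField K] (L : Type) [Field L] [NumberField L] [Algebra K L]

/-- THE PLACES OF `K` THE ROUTE READS: the finite places and the real places (TIER5 §N5.5: finite non-split, finite
split, real — `F = K⁺` is totally real, so these are all its places). -/
abbrev GlobalIndex : Type :=
  HeightOneSpectrum (NumberField.RingOfIntegers K) ⊕ {τ : NumberField.InfinitePlace K // τ.IsReal}

/-- «Exactly one place of `L` lies above `v`» — the finite place `v` of `K` is non-split in `L`. -/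
def IsNonSplit (v : HeightOneSpectrum (NumberField.RingOfIntegers K)) : Prop :=
  ∃! w : HeightOneSpectrum (NumberField.RingOfIntegers L), w.asIdeal.LiesOver v.asIdeal

open Classical in
/-- THE KIND OF EACH PLACE from the global structure: `ns` at a finite place with exactly one place of `L` above it,
`sp` at the other finite places, `re` at a real place. -/
def kindOf : GlobalIndex K → PlaceKind :=
  Sum.elim (fun v => if IsNonSplit K L v then PlaceKind.ns else PlaceKind.sp) (fun _ => PlaceKind.re)

variable {K L}

open Classical in
omit [NumberField K] [NumberField L] in
/-- The kind of a finite place. -/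
theorem kindOf_inl (v : HeightOneSpectrum (NumberField.RingOfIntegers K)) :
    kindOf K L (Sum.inl v) = if IsNonSplit K L v then PlaceKind.ns else PlaceKind.sp :=
  rfl

omit [NumberField K] [NumberField L] in
/-- A real place has kind `re`. -/
theorem kindOf_inr (τ : {τ : NumberField.InfinitePlace K // τ.IsReal}) : kindOf K L (Sum.inr τ) = PlaceKind.re :=
  rfl

omit [NumberField K] [NumberField L] in
/-- A finite place of kind `ns` is non-split. -/
theorem isNonSplit_of_kindOf {v : HeightOneSpectrum (NumberField.RingOfIntegers K)}
    (h : kindOf K L (Sum.inl v) = PlaceKind.ns) : IsNonSplit K L v := by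
  by_contra hv
  rw [kindOf_inl, if_neg hv] at h
  exact absurd h (by decide)

omit [NumberField K] [NumberField L] in
/-- A non-split finite place has kind `ns`. -/
theorem kindOf_eq_ns {v : HeightOneSpectrum (NumberField.RingOfIntegers K)} (h : IsNonSplit K L v) :
    kindOf K L (Sum.inl v) = PlaceKind.ns := by
  rw [kindOf_inl, if_pos h]

omit [NumberField K] [NumberField L] in
/-- A real place never has kind `ns`. -/
theorem kindOf_inr_ne_ns (τ : {τ : NumberField.InfinitePlace K // τ.IsReal}) :
    kindOf K L (Sum.inr τ) ≠ PlaceKind.ns := by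
  rw [kindOf_inr]
  decide

omit [NumberField K] [NumberField L] in
/-- A place of kind `re` is a real place. -/
theorem exists_eq_inr_of_kindOf_eq_re {x : GlobalIndex K} (hx : kindOf K L x = PlaceKind.re) :
    ∃ τ, x = Sum.inr τ := by
  rcases x with v | τ
  · exfalso
    by_cases hv : IsNonSplit K L v
    · rw [kindOf_inl, if_pos hv] at hx
      exact absurd hx (by decide)
    · rw [kindOf_inl, if_neg hv] at hx
      exact absurd hx (by decide)
  · exact ⟨τ, rfl⟩

/-- The place of `L` above a non-split finite place `v`. -/
def placeAbove {v : HeightOneSpectrum (NumberField.RingOfIntegers K)} (h : IsNonSplit K L v) :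
    HeightOneSpectrum (NumberField.RingOfIntegers L) :=
  h.choose

omit [NumberField K] [NumberField L] in
/-- … lies over `v` (an instance, so that the completion of `L` at it is a `K_v`-algebra). -/
instance placeAbove_liesOver {v : HeightOneSpectrum (NumberField.RingOfIntegers K)} (h : IsNonSplit K L v) :
    (placeAbove h).asIdeal.LiesOver v.asIdeal :=
  h.choose_spec.1

omit [NumberField K] [NumberField L] in
/-- … and is the only one. -/
theorem placeAbove_unique {v : HeightOneSpectrum (NumberField.RingOfIntegers K)} (h : IsNonSplit K L v)
    (w' : HeightOneSpectrum (NumberField.RingOfIntegers L)) (hw' : w'.asIdeal.LiesOver v.asIdeal) :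
    w' = placeAbove h :=
  h.choose_spec.2 w' hw'

variable (K L) in
/-- THE THREE DATA AT EVERY NON-SPLIT FINITE PLACE (the input of the N side on the finite places): for each finite
place `v` of `K` non-split in `L`, the three data at the place of `L` above it. -/
def ThreeDataFamily : Type 1 :=
  ∀ (v : HeightOneSpectrum (NumberField.RingOfIntegers K)) (h : IsNonSplit K L v), ThreeData v (placeAbove h)

variable (hKL : Module.finrank K L = 2) (T : ThreeDataFamily K L)

/-- The local input at a non-split finite place from the three data. -/
def localInputAt {v : HeightOneSpectrum (NumberField.RingOfIntegers K)} (h : IsNonSplit K L v) :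
    LocalInput v (placeAbove h) :=
  LocalInput.ofUnique v (placeAbove h) hKL (placeAbove_unique h) (T v h)

/-- THE PLACE FAMILY OF THE QUADRATIC EXTENSION from the global structure: the kinds `kindOf`, and at every finite
non-split place the local input `ofUnique` from the three data. -/
def PlaceFamily.ofGlobal : PlaceFamily K L (GlobalIndex K) where
  kind := kindOf K L
  ns := fun x hx =>
    match x, hx with
    | Sum.inl v, hx => ⟨v, placeAbove (isNonSplit_of_kindOf hx), localInputAt hKL T (isNonSplit_of_kindOf hx)⟩
    | Sum.inr τ, hx => absurd hx (kindOf_inr_ne_ns (K := K) (L := L) τ)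

/-- The per-place hypotheses of the global family are the hypotheses of the three data at every non-split finite
place. -/
theorem PlaceFamily.ofGlobal_hyps_iff :
    (PlaceFamily.ofGlobal hKL T).Hyps ↔
      ∀ (v : HeightOneSpectrum (NumberField.RingOfIntegers K)) (h : IsNonSplit K L v),
        (localInputAt hKL T h).Hyps := by
  constructor
  · intro hF v h
    exact hF (Sum.inl v) (kindOf_eq_ns h)
  · intro hT x hx
    rcases x with v | τ
    · exact hT v (isNonSplit_of_kindOf hx)
    · exact absurd hx (kindOf_inr_ne_ns (K := K) (L := L) τ)

/-- THE HOST-SHAPED STATEMENT (ledger rows 183–184 on the places of `K`): three data at every non-split finite place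
with the per-place hypotheses of the statements of record v2, and real data on both sides at every real place with
t6-p7's three hypotheses, give a sign model on the places of `K` — kinds the global ones, local data the statements
of record's — with `Solves ∧ RealCondB`. -/
theorem exists_signModel_ofGlobal
    (hT : ∀ (v : HeightOneSpectrum (NumberField.RingOfIntegers K)) (h : IsNonSplit K L v),
      (localInputAt hKL T h).Hyps)
    (RA RB : GlobalIndex K → RealData)
    (h35A : ∀ τ : {τ : NumberField.InfinitePlace K // τ.IsReal}, Hyp.BFGYYZ2025_Thm3_5 (RA (Sum.inr τ)).toLocal)
    (h35B : ∀ τ : {τ : NumberField.InfinitePlace K // τ.IsReal}, Hyp.BFGYYZ2025_Thm3_5 (RB (Sum.inr τ)).toLocal)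
    (hFA : ∀ τ : {τ : NumberField.InfinitePlace K // τ.IsReal}, (RA (Sum.inr τ)).FockDict)
    (hFB : ∀ τ : {τ : NumberField.InfinitePlace K // τ.IsReal}, (RB (Sum.inr τ)).FockDict)
    (hHA : ∀ τ : {τ : NumberField.InfinitePlace K // τ.IsReal}, ∀ i, (RA (Sum.inr τ)).HalfLine i)
    (hHB : ∀ τ : {τ : NumberField.InfinitePlace K // τ.IsReal}, ∀ i, (RB (Sum.inr τ)).HalfLine i) :
    ∃ S : SignModel (GlobalIndex K), S.kind = kindOf K L ∧ S.D = (PlaceFamily.ofGlobal hKL T).D ∧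
      S.Solves ∧ S.RealCondB := by
  have hF : (PlaceFamily.ofGlobal hKL T).Hyps := (PlaceFamily.ofGlobal_hyps_iff hKL T).mpr hT
  have hre : ∀ x : GlobalIndex K, (PlaceFamily.ofGlobal hKL T).kind x = PlaceKind.re → ∃ τ, x = Sum.inr τ :=
    fun x hx => exists_eq_inr_of_kindOf_eq_re hx
  refine ⟨(PlaceFamily.ofGlobal hKL T).signModel hF RA RB, rfl, rfl,
    (PlaceFamily.ofGlobal hKL T).signModel_solves hF RA RB,
    (PlaceFamily.ofGlobal hKL T).signModel_realCondB hF RA RB ?_ ?_ ?_ ?_ ?_ ?_⟩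
  · intro x hx
    obtain ⟨τ, rfl⟩ := hre x hx
    exact h35A τ
  · intro x hx
    obtain ⟨τ, rfl⟩ := hre x hx
    exact h35B τ
  · intro x hx
    obtain ⟨τ, rfl⟩ := hre x hx
    exact hFA τ
  · intro x hx
    obtain ⟨τ, rfl⟩ := hre x hx
    exact hFB τ
  · intro x hx
    obtain ⟨τ, rfl⟩ := hre x hx
    exact hHA τ
  · intro x hx
    obtain ⟨τ, rfl⟩ := hre x hx
    exact hHB τ

end Global

end

end Summit.Ventures.HodgeRepro2.T6.N5LocalSignModelGlobal
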